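import Summits.HodgeConjecture.HodgeConjecture.Theorems.F0P3PNullMapIsCocycle
import HarnessLib

/-!
# FLOOR-0 P3b «ENGINE local packets T3 ∕ T4», line `F0_LocalAPackets` — THEOREMS-SIDE DEFS LEAF (§1 of the line, VERBATIM)

Cell hodgecm-mathlib (D-0151), FLOOR 0, crux item H413 = stmt-HodgeConjecture-24833; sub-line
`Cruxes/H413/Lines/F0_LocalAPackets.lean` (F0P3b-plan (g4), edition 1, commit 2a4b8a813d3e).  F0P3b-plan (g5) pen word
2026-08-31T01:15:49Z: «put BOTH route-posited §1 defs `HasInvariantHermitianForm` ∕ `IsLadderValueMap` verbatim into ONE tiny defs leaf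
`Theorems/F0P3bLocalAPacketsDefs.lean` (+ the `upqTypeClasses_ne_bot_of_isLadderValueMap` lemma) that B4 ∕ B5 ∕ B3 all import; I fold the
Lines file onto it in ed. 1.1».  This is that leaf: the floor-importable twin of the line's §1 (the Lines module itself is never imported
by `Theorems/` files, director s347 ∕ s380b) — `G21`, `HasInvariantHermitianForm`, `IsLadderValueMap` with def bodies BYTE-FOR-BYTE
those of the line, and the ★ J2 read-through `upqTypeClasses_ne_bot_of_isLadderValueMap` (proved, over ★
`F0P3PNullMapIsCocycle.typeClasses_ne_bot_of_linearMap`).  Author A-p18 (g17).  DEF lane (two `def`s + one `abbrev` + one theorem; no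
`sorry`, no instance, no notation, no named fact).  Imports: ★ `Theorems.F0P3PNullMapIsCocycle` (+ HarnessLib) only — not on the R2
reverse cone.

Sources: [BorelWallach2000] II §4.1–4.2, VI Thm 4.12; [Kovacevic2021] §4 Thm 4; [Rogawski1990] §12.3 p. 178.
HONEST LABEL: HC_CM is proved only modulo the printed citations until rung 0 closes; this file asserts nothing (definitions + one ★-derived lemma).
-/

set_option autoImplicit false
set_option linter.dupNamespace false

namespace Summit.HodgeConjecture.HodgeConjecture.Cruxes.H413.F0P3bLocalAPacketsDefs

open Literature.NumberTheory.Automorphic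
open Literature.RepresentationTheory.BorelWallach2000
open Literature.RepresentationTheory.KonnoKonno2007 Literature.RepresentationTheory.KonnoKonno2007.RealDualPair
open Literature.RepresentationTheory.KonnoKonno2007.RealDualPair.UForm
open Summit.HodgeConjecture.HodgeConjecture.Cruxes.H413.F0P3PNullMapIsCocycle

-- Mathlib idiom (as in `GKModules`, the `Upq*` files and the T6 package): commutator bracket on `Module.End`
attribute [local instance 100] LieRing.ofAssociativeRing

/-! ## §1 Definitions (VERBATIM from `Lines/F0_LocalAPackets.lean` §1) -/

/-- The real group `U(2,1)` of record (Borel–Wallach ∕ Konno–Konno layer; VERBATIM from the line). -/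
noncomputable abbrev G21 : RealMatrixGroup ℂ (Fin 2 ⊕ Fin 1) := uFormGroup (Fin 2) (Fin 1)

section Generic

variable {α β : Type} [Fintype α] [DecidableEq α] [Fintype β] [DecidableEq β]
  {V : Type} [AddCommGroup V] [Module ℂ V]

/-- **An invariant positive-definite Hermitian form** for the `𝔤`-action of a `(𝔤, K)`-module of `U(α, β)`: `H` conjugate-linear in
the first variable, Hermitian, positive definite, and every `ρ𝔤(X)`, `X ∈ 𝔲(α, β)`, is `H`-skew — the natural unitarity notion of
Kovačević's ★ `SU21Datum.IsUnitarizable` transported to the real form, and of an `L²`-realisation.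
(BorelWallach2000, VI Thm 4.12; Kovacevic2021, §4 Thm 4) — a route-posited predicate of the engine line, not a result of the literature (hence untagged). -/
def HasInvariantHermitianForm (ρ𝔤 : (uFormGroup α β).lie →ₗ⁅ℝ⁆ Module.End ℂ V) : Prop :=
  ∃ H : V →ₗ⋆[ℂ] V →ₗ[ℂ] ℂ,
    (∀ v w, H v w = starRingEnd ℂ (H w v)) ∧ (∀ v, v ≠ 0 → 0 < (H v v).re) ∧
    ∀ (X : (uFormGroup α β).lie) (v w : V), H (ρ𝔤 X v) w = -H v (ρ𝔤 X w)

/-- **A ladder value-map datum of sign `δ`** on a `(𝔤, K)`-module of `U(α, β)`: a non-zero real-linear `φ : 𝔤 → V` vanishing on `𝔨`,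
`K`- and `𝔨`-equivariant, whose values have `z₀`-weight `δi` and are `𝔭^{−δ}`-null — exactly the hypotheses of the ★ J2-converse
`F0P3PNullMapIsCocycle.typeClasses_ne_bot_of_linearMap` (VERBATIM).  For `U(2,1)` and Kovačević's `Z(3)`: `φ` = the `K`-equivariant
identification of `𝔭^{δ}` with the vertex `K`-type `V_{2,3}`. (BorelWallach2000, II §4.1–4.2) — a route-posited predicate of the engine line, not a result of the literature (hence untagged). -/
def IsLadderValueMap (ρK : Representation ℂ (uFormGroup α β).maximalCompact V)
    (ρ𝔤 : (uFormGroup α β).lie →ₗ⁅ℝ⁆ Module.End ℂ V) (δ : ℤ) (φ : (uFormGroup α β).lie →ₗ[ℝ] V) : Prop :=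
  φ ≠ 0 ∧
  (∀ W ∈ (uFormGroup α β).kInLie, φ W = 0) ∧
  (∀ (k : (uFormGroup α β).maximalCompact) (X : (uFormGroup α β).lie),
    ρK k (φ X) = φ ((uFormGroup α β).Ad (Subgroup.inclusion (uFormGroup α β).maximalCompact_le_carrier k) X)) ∧
  (∀ W ∈ (uFormGroup α β).kInLie, ∀ X : (uFormGroup α β).lie, φ ⁅W, X⁆ = ρ𝔤 W (φ X)) ∧
  (∀ X : (uFormGroup α β).lie, ρ𝔤 (upqZ0 α β) (φ X) = ((δ : ℂ) * Complex.I) • φ X) ∧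
  (∀ (X : (uFormGroup α β).lie) (s : (α × β) × Fin 2),
    ρ𝔤 (upqPBasis s) (φ X) + ((δ : ℂ) * Complex.I) • ρ𝔤 ⁅upqZ0 α β, upqPBasis s⁆ (φ X) = 0)

/-- The ★ J2-converse read through `IsLadderValueMap`: on an irreducible `Ad`-compatible `(𝔤, K)`-module a ladder value map of
sign `δ = ±1` gives a non-zero degree-one class of type `δ`. [cite: BorelWallach2000, II §4.2] -/
theorem upqTypeClasses_ne_bot_of_isLadderValueMap (ρK : Representation ℂ (uFormGroup α β).maximalCompact V)
    (ρ𝔤 : (uFormGroup α β).lie →ₗ⁅ℝ⁆ Module.End ℂ V) (hgk : IsGKModule (uFormGroup α β) ρK ρ𝔤)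
    (hirr : IsIrreducibleGK ρK ρ𝔤) {δ : ℤ} (hδ : δ = 1 ∨ δ = -1) {φ : (uFormGroup α β).lie →ₗ[ℝ] V}
    (hφ : IsLadderValueMap ρK ρ𝔤 δ φ) :
    upqTypeClasses ρK ρ𝔤 hgk.ad_compat 1 δ ≠ ⊥ := by
  obtain ⟨hφ0, h0, hK, h𝔨, hwt, hN⟩ := hφ
  exact typeClasses_ne_bot_of_linearMap ρK ρ𝔤 hgk.ad_compat hirr hδ φ hφ0 h0 hK h𝔨 hwt hN

end Generic


end Summit.HodgeConjecture.HodgeConjecture.Cruxes.H413.F0P3bLocalAPacketsDefs
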